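import Literature.Analysis.FluidPDE.AxisymmetricEuler
import Literature.Analysis.FluidPDE.AxisymmetricLiftR5
import Literature.Analysis.FluidPDE.Chen2020DissipativeGCLM
import HarnessLib

/-!
# Córdoba–Martínez-Zoroa–Zheng: non-self-similar finite-time singularities for
# `C^∞(ℝ³ ∖ {0}) ∩ C^{1,α} ∩ L²` solutions of 3D Euler, and for the generalised De Gregorio model

Topic `Literature/Analysis/FluidPDE`. Statements file (two NAMED FACTS with cite tags, the notions they
need taken from the tree; the elementary consequences are proved). Source:
`[CordobaMartinezzoroaZheng2023]` D. Córdoba, L. Martínez-Zoroa, F. Zheng, *Finite time singularities to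
the 3D incompressible Euler equations for solutions in `C^∞(ℝ³ ∖ {0}) ∩ C^{1,α} ∩ L²`*, Ann. PDE 11
(2025) no. 2, Paper 19 = arXiv:2308.12197 ("p." = chunk of the held text `paper:arxiv-2308.12197`).
A mechanism of blow-up for axisymmetric swirl-free Euler flows with `C^{1,α}` velocity, `α` small,
which is NOT built in self-similar coordinates: "infinitely many regions with vorticity, separated
by vortex-free regions in between", converging to the origin (Abstract, p. 2; §1 p. 4), driven by a
hyperbolic saddle at the origin and an explicitly solvable infinite ODE system for the bump heights
(§1.3, p. 5–6). The printed statements: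

* **Theorem 2** (§1.2, p. 5): "There exist solutions of the 3D incompressible Euler equations in
  `ℝ³ × [−T, 0]` such that on the time interval `−T ≤ t < 0`, the velocity `u` is in the space
  `C^∞(ℝ³ ∖ {0}) ∩ C^{1,α}(ℝ³) ∩ L²` and the vorticity `ω = ∇ × u` satisfies
  `1/|Ct| ≤ max|ω(·, t)| ≤ C/|t|`." Remark 3: "The velocity field we construct is axi-symmetric flows
  without swirl, whose `z` component is odd in `z`. Note that smooth axi-symmetric flows without swirl
  have global regularity, so our construction has the minimal number of singularities in the initial
  data." Remark 5: "Our solution has finite energy and compactly supported vorticity, whose maximum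
  grows like `1/t` towards the blow up time. This is consistent with the Beale–Kato–Majda criterion."
  Remark 6: "The Hölder exponent of the initial data is effective … It is an open question whether
  one can reach the `1/3` threshold (see Remark 1.5 of [Elgindi2])." §3.5 p. 21: "`u` is weak
  solution to the 3D Euler solution with finite, conserved energy, that is smooth away from the
  origin"; §3.6 Thm 6 (Hölder continuity of `ω` and `∇u` for `|t|` small), Thm 7 (the rate);
  §3.6.3: non-asymptotic self-similarity is NOT proved in 3D ("the authors … have not set themselves
  the task of proving non-asymptotic self-similarity rigorously").
* **Theorem 1** (§1.2, p. 5): "For any `a > 0`, there are `s ∈ (0, 1)`, `T > 0`, `C > 0` and a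
  solution to the generalized De Gregorio equation `∂ₜw + a u ∂ₓw = w Hw`, `∂ₓu = Hw` on the time
  interval `−T ≤ t < 0` such that for all `t` in this interval, the function
  `w(·, t) ∈ C^∞(ℝ ∖ {0}) ∩ C^s(ℝ)` and that `1/|Ct| ≤ max|w(·, t)| ≤ C/|t|`." Remark 1: `w` is odd
  (so `u` is odd); Remark 2 / §2.6 Thms 4–5: rate `1/|t|`, not asymptotically self-similar (in the
  sense of Chen); §2.5 p. 12: `w` "satisfies the De Gregorio equation classically away from `0`" and
  is a distributional solution; §2.6.2 p. 13: `w(x, t) = 0` for `|x| > 1 + 2r` (compact support).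

## Rendering

* `CordobaMartinezZoroaZheng2023.holderEulerBlowup` (Thm 2 with Remarks 3, 5 and §3.5): there are
  `α > 0`, `T > 0`, `C > 0` and `(u, p)` on `ℝ³ × [−T, 0)` with: `u`, `p` jointly `C¹` on
  `[−T, 0) × (ℝ³ ∖ {0})` and the momentum equation `∂ₜu + (u·∇)u = −∇p` there (classical away from
  the origin — the printed "weak solution … smooth away from the origin"; the one-sided time
  derivative `timeDerivWithin [−T,0)` as in the tree's `IsClassicalEulerOnDomain`), `div u(t) = 0` on
  all of `ℝ³`; every slice `u(t)`, `−T ≤ t < 0`, in `C^{1,α}(ℝ³)` (`MemC1Holder`), `C^∞` on `ℝ³ ∖ {0}`,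
  of finite and conserved energy, with compactly supported vorticity, axisymmetric, swirl-free and
  mirror-symmetric in `z` (`u(Sx) = S u(x)`, `S = reflC 2`: "`z` component odd in `z`"); and the
  two-sided rate `‖ω(t, x)‖ ≤ C/|t|` for all `x`, `1/(C|t|) ≤ ‖ω(t, x_t)‖` for some `x_t`. The
  behaviour AT `t = 0` (the solution is continued weakly to `t = 0`, where `u` "is not `C¹`",
  Abstract) is not rendered; nor is the (unproved in 3D) non-self-similarity.
* `CordobaMartinezZoroaZheng2023.gDGHolderBlowup` (Thm 1 with Remark 1, §2.5–2.6): for every `a > 0`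
  there are `0 < s < 1`, `T > 0`, `C > 0` and `w` on `ℝ × [−T, 0)`, every slice odd, compactly
  supported, `C^∞` on `ℝ ∖ {0}` and in `C^{0,s}_b(ℝ)` (`FunctionSpaces.MemContDiffHolder 0 s`), solving
  `∂ₜw = −a u ∂ₓw + w Hw` classically at every `x ≠ 0` (one-sided time derivative within `[−T, 0)`),
  with `Hw = lineHilbert (w t)` and `u = lineVelocity (w t) = ∫₀ˣ Hw` — the tree's line vocabulary of
  `Chen2020DissipativeGCLM.lean`, same equation and sign conventions (`ω_t + a u ω_x = u_x ω`,
  `u_x = Hω`, `u(0) = 0` for odd data) — and the two-sided rate `|w(t, x)| ≤ C/|t|`,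
  `1/(C|t|) ≤ |w(t, x_t)|`. Non-asymptotic self-similarity (Thm 5) is not rendered (it needs Chen's
  dynamic-rescaling notion).
* Proved: the lower rate bound forces vorticity blow-up at `t = 0` in the tree's sense
  (`vorticityBlowsUpAt_zero_of_rate_lower`, `holderEulerBlowup.exists_vorticityBlowsUpAt`); the upper
  bound is the Type-I (in vorticity) shape `sup_t |t|·‖ω(t)‖_∞ ≤ C` (`holderEulerBlowup.typeI_vorticity`).

## What this is NOT

Not Navier–Stokes and not a statement with viscosity: inviscid, `C^{1,α}` with `α ≪ 1`, swirl-free (a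
class in which viscous flows are globally regular — tree `axisymmetric_no_swirl_global_regularity`).
-/

noncomputable section

open MeasureTheory Set Function Filter
open _root_.Topology
open scoped NNReal ENNReal ContDiff

namespace Literature.Analysis.FluidPDE

namespace CordobaMartinezZoroaZheng2023

/-! ### Theorem 2: the 3D Euler blow-up -/

/-- **Córdoba–Martínez-Zoroa–Zheng, Theorem 2** (Ann. PDE 11 (2025) = arXiv:2308.12197, §1.2 p. 5:
"There exist solutions of the 3D incompressible Euler equations in `ℝ³ × [−T, 0]` such that on the time
interval `−T ≤ t < 0`, the velocity `u` is in the space `C^∞(ℝ³ ∖ {0}) ∩ C^{1,α}(ℝ³) ∩ L²` and the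
vorticity `ω = ∇ × u` satisfies `1/|Ct| ≤ max|ω(·,t)| ≤ C/|t|`"; Remark 3: axisymmetric without swirl,
`z` component odd in `z`; Remark 5: finite energy, compactly supported vorticity; §3.5 p. 21: weak
solution with finite conserved energy, smooth away from the origin). **Rendering** (module docstring):
`∃ α > 0, T > 0, C > 0` and `(u, p)` with `u, p ∈ C¹([−T,0) × (ℝ³ ∖ {0}))` solving
`∂ₜu + (u·∇)u = −∇p` at every `(t, x)`, `−T ≤ t < 0`, `x ≠ 0`, `div u(t) ≡ 0` on `ℝ³`; slices
`u(t) ∈ C^{1,α}(ℝ³)`, `C^∞` on `ℝ³ ∖ {0}`, finite conserved energy, compactly supported vorticity,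
axisymmetric, swirl-free, `u(t)(Sx) = S u(t)(x)` for the reflection `S` in `{x₂ = 0}`; and
`‖ω(t,x)‖ ≤ C/|t|` for all `x`, `1/(C|t|) ≤ ‖ω(t,x_t)‖` for some `x_t`, for every `t ∈ [−T, 0)`. [cite: CordobaMartinezzoroaZheng2023, Thm 2 with Remarks 3, 5, 6 (§1.2, p. 5 of arXiv:2308.12197); §3.5 (p. 21); §3.6 Thms 6–7 (p. 21–22)] -/
def holderEulerBlowup : Prop :=
  ∃ (α : ℝ≥0) (T C : ℝ), 0 < α ∧ 0 < T ∧ 0 < C ∧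
    ∃ (u : ℝ → EuclideanSpace ℝ (Fin 3) → EuclideanSpace ℝ (Fin 3))
      (p : ℝ → EuclideanSpace ℝ (Fin 3) → ℝ),
      -- classical Euler away from the origin on `[−T, 0) × (ℝ³ ∖ {0})`
      ContDiffOn ℝ 1 (uncurry u) (Ico (-T) 0 ×ˢ {0}ᶜ) ∧
      ContDiffOn ℝ 1 (uncurry p) (Ico (-T) 0 ×ˢ {0}ᶜ) ∧
      (∀ t ∈ Ico (-T) 0, ∀ x : EuclideanSpace ℝ (Fin 3), x ≠ 0 →
        timeDerivWithin (Ico (-T) 0) u t x + convect (u t) (u t) x = -gradient (p t) x) ∧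
      (∀ t ∈ Ico (-T) 0, ∀ x, VectorCalculus.divergence (u t) x = 0) ∧
      -- the slices
      (∀ t ∈ Ico (-T) 0,
        MemC1Holder α (u t) ∧ ContDiffOn ℝ ∞ (u t) {0}ᶜ ∧ HasFiniteEnergy (u t) ∧
        eEnergy (u t) = eEnergy (u (-T)) ∧ HasCompactSupport (curl (u t)) ∧
        IsAxisymmetric (u t) ∧ HasNoSwirl (u t) ∧ (∀ x, u t (reflC 2 x) = reflC 2 (u t x))) ∧
      -- the two-sided blow-up rate `1/(C|t|) ≤ max|ω(·,t)| ≤ C/|t|`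
      (∀ t ∈ Ico (-T) 0,
        (∀ x, ‖curl (u t) x‖ ≤ C / |t|) ∧ ∃ x, 1 / (C * |t|) ≤ ‖curl (u t) x‖)

/-- A lower rate bound `c/|t| ≤ ‖ω(t, x_t)‖` on `[−T, 0)`, `c > 0`, forces vorticity blow-up at `t = 0`
in the tree's sense (`VorticityBlowsUpAt u 0`): for every `M`, all `t < 0` close to `0` carry a value
`> M` (Remark 5: "consistent with the Beale–Kato–Majda criterion"). [cite: CordobaMartinezzoroaZheng2023, Thm 2 and Remark 5 (p. 5)] -/
theorem vorticityBlowsUpAt_zero_of_rate_lower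
    {u : ℝ → EuclideanSpace ℝ (Fin 3) → EuclideanSpace ℝ (Fin 3)} {T c : ℝ} (hT : 0 < T) (hc : 0 < c)
    (h : ∀ t ∈ Ico (-T) 0, ∃ x, c / |t| ≤ ‖curl (u t) x‖) : VorticityBlowsUpAt u 0 := by
  intro M
  have hM1 : 0 < max M 0 + 1 := by positivity
  set δ : ℝ := min T (c / (max M 0 + 1)) with hδ
  have hδpos : 0 < δ := lt_min hT (div_pos hc hM1)
  have hwin : ∀ᶠ t in 𝓝[<] (0 : ℝ), t ∈ Ioo (-δ) 0 := Ioo_mem_nhdsLT (by linarith)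
  refine (hwin.mono fun t ht => ?_).frequently
  have htT : t ∈ Ico (-T) 0 := ⟨by linarith [ht.1, min_le_left T (c / (max M 0 + 1))], ht.2⟩
  obtain ⟨x, hx⟩ := h t htT
  refine ⟨x, lt_of_lt_of_le ?_ hx⟩
  have habs : |t| = -t := abs_of_neg ht.2
  have hpos : 0 < |t| := by rw [habs]; linarith [ht.2]
  have hlt : |t| < c / (max M 0 + 1) := by
    rw [habs]; linarith [ht.1, min_le_right T (c / (max M 0 + 1))]
  have h1 : M < max M 0 + 1 := (le_max_left M 0).trans_lt (lt_add_one _)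
  have h2 : max M 0 + 1 = c / (c / (max M 0 + 1)) := by rw [div_div_cancel₀ hc.ne']
  have h3 : c / (c / (max M 0 + 1)) < c / |t| := div_lt_div_of_pos_left hc hpos hlt
  linarith

/-- From Theorem 2: a swirl-free axisymmetric `C^{1,α}` velocity field on `ℝ³ × [−T, 0)`, classical
Euler away from the origin and divergence free, whose vorticity blows up at `t = 0`
(`VorticityBlowsUpAt`). [cite: CordobaMartinezzoroaZheng2023, Thm 2 (p. 5)] -/
theorem holderEulerBlowup.exists_vorticityBlowsUpAt (h : holderEulerBlowup) :
    ∃ (α : ℝ≥0) (T : ℝ) (u : ℝ → EuclideanSpace ℝ (Fin 3) → EuclideanSpace ℝ (Fin 3)),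
      0 < α ∧ 0 < T ∧
      (∀ t ∈ Ico (-T) 0, MemC1Holder α (u t) ∧ HasFiniteEnergy (u t) ∧
        IsAxisymmetric (u t) ∧ HasNoSwirl (u t)) ∧
      VorticityBlowsUpAt u 0 := by
  obtain ⟨α, T, C, hα, hT, hC, u, p, -, -, -, -, hslice, hrate⟩ := h
  refine ⟨α, T, u, hα, hT, fun t ht => ?_, ?_⟩
  · obtain ⟨h1, -, h3, -, -, h6, h7, -⟩ := hslice t ht
    exact ⟨h1, h3, h6, h7⟩
  · refine vorticityBlowsUpAt_zero_of_rate_lower hT (one_div_pos.2 hC) fun t ht => ?_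
    obtain ⟨x, hx⟩ := (hrate t ht).2
    exact ⟨x, by rwa [div_div, one_div] at *⟩

/-- The upper bound of Theorem 2 is the Type-I shape in vorticity: `|t| · ‖ω(t, x)‖ ≤ C` for all
`x` and all `t ∈ [−T, 0)` (Remark 5: the maximum "grows like `1/t`"). [cite: CordobaMartinezzoroaZheng2023, Thm 2 and Remark 5 (p. 5); Thm 7 (p. 22)] -/
theorem holderEulerBlowup.typeI_vorticity (h : holderEulerBlowup) :
    ∃ (T C : ℝ) (u : ℝ → EuclideanSpace ℝ (Fin 3) → EuclideanSpace ℝ (Fin 3)), 0 < T ∧ 0 < C ∧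
      VorticityBlowsUpAt u 0 ∧ ∀ t ∈ Ico (-T) 0, ∀ x, |t| * ‖curl (u t) x‖ ≤ C := by
  obtain ⟨α, T, C, hα, hT, hC, u, p, -, -, -, -, -, hrate⟩ := h
  refine ⟨T, C, u, hT, hC, ?_, fun t ht x => ?_⟩
  · refine vorticityBlowsUpAt_zero_of_rate_lower hT (one_div_pos.2 hC) fun t ht => ?_
    obtain ⟨x, hx⟩ := (hrate t ht).2
    exact ⟨x, by rwa [div_div, one_div] at *⟩
  · have hpos : 0 < |t| := abs_pos.2 (ne_of_lt ht.2)
    have := (hrate t ht).1 x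
    rwa [le_div_iff₀ hpos, mul_comm] at this

/-! ### Theorem 1: the generalised De Gregorio model on the line -/

/-- **Córdoba–Martínez-Zoroa–Zheng, Theorem 1** (§1.2 p. 5: "For any `a > 0`, there are `s ∈ (0, 1)`,
`T > 0`, `C > 0` and a solution to the generalized De Gregorio equation `∂ₜw + a u ∂ₓw = w Hw`,
`∂ₓu = Hw` on the time interval `−T ≤ t < 0` such that for all `t` in this interval, the function
`w(·, t) ∈ C^∞(ℝ ∖ {0}) ∩ C^s(ℝ)` and that `1/|Ct| ≤ max|w(·, t)| ≤ C/|t|`"; Remark 1: `w` odd;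
§2.5 p. 12: the equation holds classically away from `0` and in the sense of distributions;
§2.6.2 p. 13: `w(x,t) = 0` for `|x| > 1 + 2r`). **Rendering** (the tree's line vocabulary of
`Chen2020DissipativeGCLM.lean`: `Hw = lineHilbert (w t)`, `u = lineVelocity (w t) = ∫₀ˣ Hw`, same
conventions `ω_t + a u ω_x = u_x ω`, `u_x = Hω`): for every `a > 0` there are `0 < s < 1`, `T > 0`,
`C > 0` and `w : ℝ → ℝ → ℝ` (time first) with every slice `w t`, `t ∈ [−T, 0)`, odd, compactly
supported, `C^∞` on `ℝ ∖ {0}` and in `C^{0,s}_b(ℝ)`; the equation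
`∂ₜw(t,x) = −a u(t,x) ∂ₓw(t,x) + w(t,x) Hw(t,x)` holding with the one-sided time derivative within
`[−T, 0)` at every `x ≠ 0`; and `|w(t,x)| ≤ C/|t|` for all `x`, `1/(C|t|) ≤ |w(t,x_t)|` for some
`x_t`. Non-asymptotic self-similarity (Thm 5) and the distributional formulation are not rendered. [cite: CordobaMartinezzoroaZheng2023, Thm 1 with Remarks 1–2 (§1.2, p. 5 of arXiv:2308.12197); §2.5 (p. 12), §2.6 Thms 3–5 (p. 12–13)] -/
def gDGHolderBlowup : Prop :=
  ∀ a : ℝ, 0 < a →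
    ∃ (s : ℝ≥0) (T C : ℝ), 0 < s ∧ s < 1 ∧ 0 < T ∧ 0 < C ∧
      ∃ w : ℝ → ℝ → ℝ,
        (∀ t ∈ Ico (-T) 0,
          (∀ x, w t (-x) = -w t x) ∧ HasCompactSupport (w t) ∧ ContDiffOn ℝ ∞ (w t) {0}ᶜ ∧
          FunctionSpaces.MemContDiffHolder 0 s (w t)) ∧
        (∀ t ∈ Ico (-T) 0, ∀ x : ℝ, x ≠ 0 →
          HasDerivWithinAt (fun τ => w τ x)
            (-(a * lineVelocity (w t) x * deriv (w t) x) + w t x * lineHilbert (w t) x)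
            (Ico (-T) 0) t) ∧
        (∀ t ∈ Ico (-T) 0, (∀ x, |w t x| ≤ C / |t|) ∧ ∃ x, 1 / (C * |t|) ≤ |w t x|)

/-- From Theorem 1: for every `a > 0` the model has a solution on some `[−T, 0)` whose sup norm is
unbounded as `t ↑ 0` — for every `M` some `(t, x)` with `M < |w(t,x)|` (the tree's shape
`SupNormBlowupBefore` is for forward windows `[0, T)`; here the window is `[−T, 0)`). [cite: CordobaMartinezzoroaZheng2023, Thm 1 (p. 5)] -/
theorem gDGHolderBlowup.exists_unbounded (h : gDGHolderBlowup) {a : ℝ} (ha : 0 < a) :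
    ∃ (T : ℝ) (w : ℝ → ℝ → ℝ), 0 < T ∧ ∀ M : ℝ, ∃ t ∈ Ico (-T) 0, ∃ x, M < |w t x| := by
  obtain ⟨s, T, C, -, -, hT, hC, w, -, -, hrate⟩ := h a ha
  refine ⟨T, w, hT, fun M => ?_⟩
  -- take `t = -δ` with `δ = min (T/2) (1/(C (|M|+1)))`: then `1/(C|t|) ≥ |M| + 1 > M`
  set δ : ℝ := min (T / 2) (1 / (C * (|M| + 1))) with hδ
  have hM1 : 0 < |M| + 1 := by positivity
  have hδpos : 0 < δ := lt_min (by linarith) (by positivity)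
  have ht : -δ ∈ Ico (-T) 0 := ⟨by linarith [min_le_left (T / 2) (1 / (C * (|M| + 1)))], by linarith⟩
  obtain ⟨x, hx⟩ := (hrate (-δ) ht).2
  refine ⟨-δ, ht, x, lt_of_lt_of_le ?_ hx⟩
  have habs : |(-δ)| = δ := by rw [abs_neg, abs_of_pos hδpos]
  rw [habs]
  have hle : δ ≤ 1 / (C * (|M| + 1)) := min_le_right _ _
  have hCδ : 0 < C * δ := mul_pos hC hδpos
  calc M ≤ |M| := le_abs_self M
    _ < |M| + 1 := lt_add_one _
    _ = 1 / (C * (1 / (C * (|M| + 1)))) := by field_simp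
    _ ≤ 1 / (C * δ) := by
        apply one_div_le_one_div_of_le hCδ
        exact mul_le_mul_of_nonneg_left hle hC.le

end CordobaMartinezZoroaZheng2023

end Literature.Analysis.FluidPDE
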